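import Summits.BirchSwinnertonDyer.BirchSwinnertonDyer.Theorems.KimAtThreeFineKatoValueEquivariance
import Summits.BirchSwinnertonDyer.Rank1Residual.GaloisImage.CyclotomicLevelFrobenius
import Literature.NumberTheory.GaloisRepresentations.CyclotomicDecompositionFrobenius
import Literature.NumberTheory.GaloisRepresentations.IntegralGaloisActionProofs
import HarnessLib

/-!
# (GAL₀) from LOCAL equivariance: the `D`-equivariance clause of a single-completion value datum
# reduces to the decomposition group `D_{𝔓₀} = res(Γ_{ℚ_p})` (crux `KatoKuriharaPortThreeShared`,
# stmt-BirchSwinnertonDyer-19560; cell `bsd-addord`, seat w2-acc5 gen 5; route W2 `KimAtThreeKolyvagin`;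
# `--supports 19560`, helper)

HONEST FRAMING.  TOOL theorem only (no definition, no named fact, no `sorry`); closes nothing; nothing is
booked; BSD is not proved by any of this.

WHAT.  `KimAtThreeFineKatoValueEquivariance.conjMap_eq_map_sigma_of_singleField` proves `ZetaBody`
(C3a) for a value datum defined through ONE completion `L_{w₀}` from the hypothesis
**(GAL₀)** `F (δ · Y) = δ̃_* (F Y)` for every `δ ∈ Γ_ℚ` whose image `δ̃ = sigma m (χ_m δ) ∈ Gal(ℚ(ζ_m)/ℚ)`
FIXES THE PLACE `w₀`.  The genuinely local statement is the same identity for `δ` in the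
decomposition group `D_{𝔓₀} = res(Γ_{ℚ_v})` only (**(GAL_D)**: `Gal(L_{w₀}/ℚ_p)`-semilinearity of
`exp*_{w₀} ∘ loc_{w₀}`).  THIS FILE proves **(GAL₀) ⟸ (GAL_D)** at the tame levels `p ∤ m`
(`singleField_gal_of_galDecomposition`): if `δ̃ • w₀ = w₀` then `χ_m(δ) = p^i`
(`Literature.…CyclotomicField.autEquivPow_eq_pow_of_smul_eq`, Washington Thm. 2.13: the stabiliser of
`w₀ ∣ p` is `⟨σ_p⟩`), an arithmetic Frobenius `φ ∈ D_{𝔓₀}` has `χ_m(φ) = p`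
(`CyclotomicLevel.Rat.modNCyclotomicCharacter_of_isArithFrobAtPlace`), so `δ = φ^i · u` with
`χ_m(u) = 1`, i.e. `u ∈ U` ((KER) `ker χ_m ≤ U`, `mem_cycSubgroup_of_modNCyclotomicCharacter_eq_one`,
every level), and `u` acts trivially on `H¹(U, T)` (`conjMap_eq_self_of_mem_one`).  So the supplier of `ZetaBody` for the
defined `Λ` owes, on the Galois side, only (GAL_D).

NOT here: (GAL_D) itself (property of the defined `exp*`); the ramified levels `p ∣ m` (there the
stabiliser also contains the image of inertia — open).

References: L. C. Washington, *Introduction to Cyclotomic Fields* (1997) Thm. 2.13 [Washington1997];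
K. Kato, Astérisque 295 (2004) §9.4 [Kato2004Asterisque]; J. Neukirch, *Algebraic Number Theory* (1999)
Ch. I (10.3), Ch. II §9 (9.6) [NeukirchANT1999]; J.-P. Serre, *Local Fields* (1979) VII §5
[SerreLocalFields1979].
-/

noncomputable section

-- the cell's Theorems namespace `Summit.BirchSwinnertonDyer.BirchSwinnertonDyer.…` repeats the summit name by design (D-0017)
set_option linter.dupNamespace false

open scoped Classical NumberField ContRepresentation TensorProduct Pointwise
open Field NumberField IsDedekindDomain
open WeierstrassCurve Literature.NumberTheory.EllipticCurves Literature.NumberTheory.GaloisRepresentations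
  Literature.NumberTheory.GaloisRepresentations.DiscreteGaloisModule
  Literature.NumberTheory.EllipticCurves.Kato2004.EulerSystemValues
open Literature.NumberTheory.AdelicBaseChange Literature.NumberTheory.Automorphic
open Summit.BirchSwinnertonDyer.Rank1Residual.GaloisImage

namespace Summit.BirchSwinnertonDyer.BirchSwinnertonDyer.Theorems.KimAtThreeFineKatoValueEquivarianceStab

variable (W : WeierstrassCurve ℚ) [W.IsElliptic] (p : ℕ) [hp : Fact p.Prime]
  [ContinuousSMul ℤ_[p] (W.tateModule p)] (k : ℕ) (r : Finset (HeightOneSpectrum (𝓞 ℚ)))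

/-- **(KER) `ker χ_m ≤ U`**: an element of `Γ_ℚ` acting trivially on `μ_m`, `m = cycLevel p k r =
p^k · ∏_{q ∈ r} ℓ_q`, lies in the level `U = cycSubgroup p k r = Gal(ℚ̄/ℚ(μ_{p^k})) ⊓ ⨅_q Gal(ℚ̄/ℚ(μ_{ℓ_q}))`
(`rootsOfUnityFixer_eq_ker`, `rootsOfUnityFixer_le_of_dvd`; every level `(k, r)`). [folklore] -/
theorem mem_cycSubgroup_of_modNCyclotomicCharacter_eq_one (u : absoluteGaloisGroup ℚ)
    (hu : modNCyclotomicCharacter ℚ (cycLevel p k r) u = 1) : u ∈ cycSubgroup p k r := by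
  have h1 : u ∈ rootsOfUnityFixer ℚ (cycLevel p k r) := by
    rw [rootsOfUnityFixer_eq_ker]; exact hu
  change u ∈ (cyclotomicLevelsRat p (∅ : Set (HeightOneSpectrum (𝓞 ℚ)))).level k r
  rw [cyclotomicLevelsRat_level]
  refine ⟨rootsOfUnityFixer_le_of_dvd ℚ (Dvd.intro _ rfl) h1, Subgroup.mem_iInf.mpr fun q => ?_⟩
  refine Subgroup.mem_iInf.mpr fun hq => rootsOfUnityFixer_le_of_dvd ℚ ?_ h1
  exact Dvd.dvd.mul_left (Finset.dvd_prod_of_mem _ hq) _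

set_option backward.isDefEq.respectTransparency false in
/-- **(GAL₀) ⟸ (GAL_D) at a tame level `p ∤ m`.**  Let `m = cycLevel p k r` with `p ∤ m`,
`U = cycSubgroup p k r`, `w₀` a place of `L = ℚ(ζ_m)` above `p` (`p ∈ w₀`) and
`F : H¹(U, T_pW) →+ L_{w₀}` additive: if `F (δ · Y) = (δ̃)_* (F Y)` for every `δ = res(δ̂)`, `δ̂ ∈ Γ_{ℚ_v}`, in
the decomposition group of `𝔓₀` whose image fixes `w₀` ((GAL_D)), then the same holds for EVERY
`δ ∈ Γ_ℚ` whose image fixes `w₀` ((GAL₀), the hypothesis of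
`KimAtThreeFineKatoValueEquivariance.conjMap_eq_map_sigma_of_singleField`).
[cite: Washington1997, Thm. 2.13] [cite: NeukirchANT1999, Ch. II §9 Prop. (9.6)] -/
theorem singleField_gal_of_galDecomposition
    (hpm : ¬ p ∣ cycLevel p k r)
    (w₀ : ((Rat.HeightOneSpectrum.primesEquiv (R := 𝓞 ℚ)).symm ⟨p, Fact.out⟩).Extension
      (𝓞 (CyclotomicField (cycLevel p k r) ℚ)))
    (hw₀ : (p : 𝓞 (CyclotomicField (cycLevel p k r) ℚ)) ∈ w₀.1.asIdeal)
    (F : H1 (tateRep W p) (cycSubgroup p k r) →+ w₀.1.adicCompletion (CyclotomicField (cycLevel p k r) ℚ))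
    (hgalD : ∀ (δ' : absoluteGaloisGroup (((Rat.HeightOneSpectrum.primesEquiv (R := 𝓞 ℚ)).symm ⟨p, Fact.out⟩).adicCompletion ℚ))
      (hδ : sigma (cycLevel p k r) (modNCyclotomicCharacter ℚ (cycLevel p k r)
        (absGaloisRestrict ℚ _ δ')) • w₀.1 = w₀.1)
      (Y : H1 (tateRep W p) (cycSubgroup p k r)),
      F (conjMap (tateRep W p).toTopRep (cycSubgroup p k r) (absGaloisRestrict ℚ _ δ') 1 Y) =
        galAdicCompletionMap (sigma (cycLevel p k r) (modNCyclotomicCharacter ℚ (cycLevel p k r)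
          (absGaloisRestrict ℚ _ δ'))) hδ (F Y))
    (δ : absoluteGaloisGroup ℚ)
    (hδ : sigma (cycLevel p k r) (modNCyclotomicCharacter ℚ (cycLevel p k r) δ) • w₀.1 = w₀.1)
    (Y : H1 (tateRep W p) (cycSubgroup p k r)) :
    F (conjMap (tateRep W p).toTopRep (cycSubgroup p k r) δ 1 Y) =
      galAdicCompletionMap (sigma (cycLevel p k r) (modNCyclotomicCharacter ℚ (cycLevel p k r) δ)) hδ (F Y) := by
  have hvp : ((Rat.HeightOneSpectrum.primesEquiv ((Rat.HeightOneSpectrum.primesEquiv (R := 𝓞 ℚ)).symm ⟨p, Fact.out⟩) : Nat.Primes) : ℕ) = p := by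
    rw [Equiv.apply_symm_apply]
  -- `χ_m(δ) = p^i` (Washington 2.13: the stabiliser of `w₀ ∣ p` is `⟨σ_p⟩`)
  obtain ⟨i, hi⟩ := CyclotomicField.autEquivPow_eq_pow_of_smul_eq hpm w₀.1 hw₀ _ hδ
  have hχδ : (modNCyclotomicCharacter ℚ (cycLevel p k r) δ : ZMod (cycLevel p k r)) =
      (p : ZMod (cycLevel p k r)) ^ i := by
    rw [← hi, sigma, MulEquiv.apply_symm_apply]
  -- an arithmetic Frobenius `φ ∈ D_{𝔓₀}` with `χ_m(φ) = p`
  obtain ⟨φ, hφ⟩ := HeightOneSpectrum.exists_isArithFrobAt_of_mem_primesAbove_holds (K := ℚ) (v := ((Rat.HeightOneSpectrum.primesEquiv (R := 𝓞 ℚ)).symm ⟨p, Fact.out⟩))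
    (adicCompletionPrime_mem_primesAbove ℚ _)
  have hχφ : (modNCyclotomicCharacter ℚ (cycLevel p k r) φ : ZMod (cycLevel p k r)) =
      (p : ZMod (cycLevel p k r)) := by
    rw [CyclotomicLevel.Rat.modNCyclotomicCharacter_of_isArithFrobAtPlace (hvp.symm ▸ hpm)
      ⟨_, adicCompletionPrime_mem_primesAbove ℚ _, hφ⟩, hvp]
  have hφD : φ ∈ (absGaloisRestrict ℚ (((Rat.HeightOneSpectrum.primesEquiv (R := 𝓞 ℚ)).symm ⟨p, Fact.out⟩).adicCompletion ℚ)).toMonoidHom.range := by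
    rw [← decompositionSubgroup_adicCompletionPrime_eq_range]
    exact Ideal.mem_decompositionSubgroup_iff.mpr hφ.mem_stabilizer
  -- `δ = φ^i · u` with `χ_m(u) = 1`, hence `u ∈ U`
  have hχeq : modNCyclotomicCharacter ℚ (cycLevel p k r) δ =
      modNCyclotomicCharacter ℚ (cycLevel p k r) φ ^ i :=
    Units.ext (by rw [Units.val_pow_eq_pow_val, hχδ, hχφ])
  have hχu : modNCyclotomicCharacter ℚ (cycLevel p k r) ((φ ^ i)⁻¹ * δ) = 1 := by
    rw [map_mul, map_inv, map_pow, hχeq, inv_mul_cancel]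
  have hu : (φ ^ i)⁻¹ * δ ∈ cycSubgroup p k r :=
    mem_cycSubgroup_of_modNCyclotomicCharacter_eq_one p k r _ hχu
  obtain ⟨δ', hδ'⟩ := pow_mem hφD i
  have hsame : sigma (cycLevel p k r) (modNCyclotomicCharacter ℚ (cycLevel p k r) (absGaloisRestrict ℚ _ δ')) =
      sigma (cycLevel p k r) (modNCyclotomicCharacter ℚ (cycLevel p k r) δ) := by
    congr 1
    have h1 := hχu
    rw [map_mul, map_inv, inv_mul_eq_one] at h1
    change modNCyclotomicCharacter ℚ (cycLevel p k r) ((absGaloisRestrict ℚ _).toMonoidHom δ') = _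
    rw [hδ', h1]
  have hδ'fix : sigma (cycLevel p k r) (modNCyclotomicCharacter ℚ (cycLevel p k r)
      (absGaloisRestrict ℚ _ δ')) • w₀.1 = w₀.1 := by rw [hsame]; exact hδ
  -- `conjMap δ = conjMap (φ^i) ∘ conjMap u = conjMap (φ^i)` on `H¹(U, T)`
  have hconj : conjMap (tateRep W p).toTopRep (cycSubgroup p k r) δ 1 Y =
      conjMap (tateRep W p).toTopRep (cycSubgroup p k r) (absGaloisRestrict ℚ _ δ') 1 Y := by
    conv_lhs => rw [show δ = φ ^ i * ((φ ^ i)⁻¹ * δ) by group, ← conjMap_conjMap,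
      conjMap_eq_self_of_mem_one _ _ hu]
    change _ = conjMap (tateRep W p).toTopRep (cycSubgroup p k r) ((absGaloisRestrict ℚ _).toMonoidHom δ') 1 Y
    rw [hδ']
  rw [hconj, hgalD δ' hδ'fix Y]
  exact galAdicCompletionMap_congr_left _ hsame _ _ _

end Summit.BirchSwinnertonDyer.BirchSwinnertonDyer.Theorems.KimAtThreeFineKatoValueEquivarianceStab

end
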